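/-
COR-CM (cell pub-hodgecm2, stage 2 of the Hodge ladder) — count-neutral KERNEL COMBINATORICS «census ↔ tree dictionary, part 9: certificates
with PRE-EXPANDED corner sets» (seat prover-pub-hodgecm2-b23-g35-0, binder prover b23, gen 35; claim DEG16-CYCLIC preparation; sequel of
`CorCM/FaceCensusHintedChecks.lean`).  Pure list combinatorics over seat b30ʼs bitmask model: two small Boolean CHECKERS (definitions)
and the theorems turning them into the hypotheses of `FaceCensus.hgen_of_hintedChecks` / `hgen_of_certOK_coverTrans`; no named fact,
nothing geometric, nothing asserted.  HONEST FRAMING (COORDINATOR RULING — HODGE FRAMING CORRECTION, 2026-08-21T11:55:35Z): `HC_CM` is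
NOT proved, here or anywhere in the tree.  T5: n/a-class.
-/
import Summits.HodgeConjecture.CorCM.FaceCensusHintedChecks
import HarnessLib

/-!
# Certificates with pre-expanded corner sets (the last quadratic factor of the census side checks)

WHY.  `certOK`/`certOKFast` evaluate the certificate identity `1_{corners f} = Σ cᵢ 1_{corners gᵢ} + Σ dⱼ 1_{{Pⱼ, P̄ⱼ}}` at EVERY CM type
(`2^{n/2}` labels) and recompute the corner set of every generator face at every label: `|cmTypes| · |terms| · cost(corners)` kernel
steps per certificate — at degree 16 a 28-certificate chunk already exceeds the kernel memory guard (farm probe 2026-08-22).  Here each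
generator term CARRIES its four corner codes (checked ONCE against `Γ.corners`), and the identity is evaluated only on the SUPPORT of the two
sides (the corners of `f`, the carried corner codes, the pair labels) — outside the support both sides vanish.  `certOK_of_certOKPre`
proves that this implies b30ʼs `certOK` for the stripped certificate VERBATIM; `hgen_of_preChecks` packages it with the hinted cover and the
flat orbit cells of part 8.  References: [cite: Pohlmann1968, Thm. 1]; [cite: Milne1999LefschetzClasses, Thm. 3.2].
-/

noncomputable section

open NumberField NumberField.ComplexEmbedding

namespace Summit.HodgeConjecture.CorCM.Census.FaceSquaresModel

namespace CMGaloisType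

variable {n : ℕ} (Γ : CMGaloisType n)

/-- Value at `L` of `Σ cᵢ 1_{Cᵢ} + Σ dⱼ 1_{{Pⱼ, P̄ⱼ}}` with the corner sets `Cᵢ` CARRIED by the terms. [folklore] -/
def comboValPre (fcx : List ((ℕ × ℕ × ℕ) × List ℕ × ℤ)) (pc : List (ℕ × ℤ)) (L : ℕ) : ℤ :=
  (fcx.map fun t => if t.2.1.contains L then t.2.2 else 0).sum +
    (pc.map fun pj => (if L == pj.1 then pj.2 else 0) + (if L == Γ.bar pj.1 then pj.2 else 0)).sum

/-- The support of a pre-expanded certificate: corners of `f`, carried corner codes, pair labels and their conjugates. [folklore] -/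
def certSupp (f : ℕ × ℕ × ℕ) (fcx : List ((ℕ × ℕ × ℕ) × List ℕ × ℤ)) (pc : List (ℕ × ℤ)) : List ℕ :=
  Γ.corners f ++ fcx.flatMap (fun t => t.2.1) ++ pc.flatMap (fun pj => [pj.1, Γ.bar pj.1])

/-- Pre-expanded certificate check: generator faces pass `isFaceB`, lie in the `𝒮`-orbits, carry their true corner sets, and the identity
holds on the support. [folklore] -/
def certOKPre (𝒮 : List (ℕ × ℕ × ℕ)) (f : ℕ × ℕ × ℕ) (fcx : List ((ℕ × ℕ × ℕ) × List ℕ × ℤ)) (pc : List (ℕ × ℤ)) : Bool :=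
  (fcx.all fun t => Γ.isFaceB t.1 && (𝒮.any fun r => Γ.isTwistOf (square r) (square t.1)) && (Γ.corners t.1 == t.2.1)) &&
    (Γ.certSupp f fcx pc).all fun L => (if (Γ.corners f).contains L then (1 : ℤ) else 0) == Γ.comboValPre fcx pc L

/-- Forget the carried corner codes. [folklore] -/
def stripTerm (t : (ℕ × ℕ × ℕ) × List ℕ × ℤ) : (ℕ × ℕ × ℕ) × ℤ := (t.1, t.2.2)

/-- Forget the carried corner codes of a whole certificate. [folklore] -/
def stripCert (c : (ℕ × ℕ × ℕ) × List ((ℕ × ℕ × ℕ) × List ℕ × ℤ) × List (ℕ × ℤ)) :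
    (ℕ × ℕ × ℕ) × List ((ℕ × ℕ × ℕ) × ℤ) × List (ℕ × ℤ) :=
  (c.1, c.2.1.map stripTerm, c.2.2)

end CMGaloisType

end Summit.HodgeConjecture.CorCM.Census.FaceSquaresModel

namespace Summit.HodgeConjecture.CorCM.FaceCensus

open Literature.AlgebraicGeometry.Motives (CMType)
open Literature.NumberTheory.ComplexMultiplication.CMTypeOps
open Summit.HodgeConjecture.CorCM.Prior.AllgGroup.RfwfAllgGroup
open Summit.HodgeConjecture.CorCM.Census.FaceSquaresModel

variable {F : Type} [Field F] [NumberField F] [IsGalois ℚ F]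
variable {n : ℕ} (Γ : CMGaloisType n) (e : GalT F ≃ Fin n)

omit [IsGalois ℚ F] in
/-- With correct carried corner sets, the pre-expanded value is b30ʼs `comboVal` of the stripped certificate. [folklore] -/
theorem comboVal_strip_eq {fcx : List ((ℕ × ℕ × ℕ) × List ℕ × ℤ)} (pc : List (ℕ × ℤ))
    (hcorr : ∀ t ∈ fcx, Γ.corners t.1 = t.2.1) (L : ℕ) :
    Γ.comboVal (fcx.map CMGaloisType.stripTerm) pc L = Γ.comboValPre fcx pc L := by
  unfold CMGaloisType.comboVal CMGaloisType.comboValPre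
  congr 1
  rw [List.map_map]
  congr 1
  apply List.map_congr_left
  intro t ht
  simp only [Function.comp_apply, CMGaloisType.stripTerm, hcorr t ht]

omit [IsGalois ℚ F] in
/-- Outside the support the pre-expanded value vanishes. [folklore] -/
theorem comboValPre_eq_zero_of_not_mem {f : ℕ × ℕ × ℕ} {fcx : List ((ℕ × ℕ × ℕ) × List ℕ × ℤ)} {pc : List (ℕ × ℤ)} {L : ℕ}
    (hL : L ∉ Γ.certSupp f fcx pc) : Γ.comboValPre fcx pc L = 0 := by
  unfold CMGaloisType.certSupp at hL
  simp only [List.mem_append, List.mem_flatMap, not_or, not_exists, not_and] at hL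
  obtain ⟨⟨-, hfc⟩, hpc⟩ := hL
  unfold CMGaloisType.comboValPre
  have h1 : (fcx.map fun t => if t.2.1.contains L then t.2.2 else 0).sum = 0 := by
    apply List.sum_eq_zero
    intro x hx
    rw [List.mem_map] at hx
    obtain ⟨t, ht, rfl⟩ := hx
    have hnot : ¬ L ∈ t.2.1 := hfc t ht
    simp [hnot]
  have h2 : (pc.map fun pj => (if L == pj.1 then pj.2 else 0) + (if L == Γ.bar pj.1 then pj.2 else 0)).sum = 0 := by
    apply List.sum_eq_zero
    intro x hx
    rw [List.mem_map] at hx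
    obtain ⟨pj, hpj, rfl⟩ := hx
    have hne := hpc pj hpj
    simp only [List.mem_cons, List.not_mem_nil, or_false, not_or] at hne
    have hb1 : (L == pj.1) = false := beq_false_of_ne hne.1
    have hb2 : (L == Γ.bar pj.1) = false := beq_false_of_ne hne.2
    simp [hb1, hb2]
  rw [h1, h2, add_zero]

omit [IsGalois ℚ F] in
/-- The pre-expanded certificate check implies b30ʼs `certOK` for the stripped certificate. [folklore] -/
theorem certOK_of_certOKPre {𝒮 : List (ℕ × ℕ × ℕ)} {f : ℕ × ℕ × ℕ} {fcx : List ((ℕ × ℕ × ℕ) × List ℕ × ℤ)} {pc : List (ℕ × ℤ)}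
    (h : Γ.certOKPre 𝒮 f fcx pc = true) : Γ.certOK 𝒮 f (fcx.map CMGaloisType.stripTerm) pc = true := by
  unfold CMGaloisType.certOKPre at h
  simp only [Bool.and_eq_true, List.all_eq_true, beq_iff_eq] at h
  obtain ⟨hterms, hsupp⟩ := h
  have hcorr : ∀ t ∈ fcx, Γ.corners t.1 = t.2.1 := fun t ht => (hterms t ht).2
  unfold CMGaloisType.certOK CMGaloisType.inOrbits
  simp only [Bool.and_eq_true, List.all_eq_true, beq_iff_eq]
  refine ⟨?_, ?_⟩
  · intro gi hgi
    rw [List.mem_map] at hgi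
    obtain ⟨t, ht, rfl⟩ := hgi
    obtain ⟨⟨hface, hany⟩, -⟩ := hterms t ht
    exact ⟨List.elem_eq_true_of_mem (mem_faces_of_isFaceB Γ hface), hany⟩
  · intro L _
    rw [comboVal_strip_eq Γ pc hcorr L]
    by_cases hs : L ∈ Γ.certSupp f fcx pc
    · exact hsupp L hs
    · have hnot : (Γ.corners f).contains L = false := by
        cases hc : (Γ.corners f).contains L
        · rfl
        · exact absurd (by unfold CMGaloisType.certSupp; simp [List.mem_of_elem_eq_true hc]) hs
      rw [hnot, comboValPre_eq_zero_of_not_mem Γ hs]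
      simp

omit [IsGalois ℚ F] in
/-- Side check 3 for a list of pre-expanded certificates implies the form consumed by `hgen_of_certOK_coverTrans` for the stripped list.
[folklore] -/
theorem certsOK_of_pre (reps : List (ℕ × ℕ × ℕ)) (cxs : List ((ℕ × ℕ × ℕ) × List ((ℕ × ℕ × ℕ) × List ℕ × ℤ) × List (ℕ × ℤ)))
    (h : (cxs.all fun c => Γ.isFaceB c.1 && Γ.certOKPre reps c.1 c.2.1 c.2.2) = true) :
    ((cxs.map CMGaloisType.stripCert).all fun c => Γ.faces.contains c.1 && Γ.certOK reps c.1 c.2.1 c.2.2) = true := by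
  rw [List.all_eq_true] at h ⊢
  intro c hc
  rw [List.mem_map] at hc
  obtain ⟨cx, hcx, rfl⟩ := hc
  have h' := h cx hcx
  rw [Bool.and_eq_true] at h' ⊢
  exact ⟨List.elem_eq_true_of_mem (mem_faces_of_isFaceB Γ h'.1), certOK_of_certOKPre Γ h'.2⟩

/-- **The census transport with PRE-EXPANDED certificates and HINTED cover.**  Same conclusion as `hgen_of_certOK_coverTrans`; `cxs` are
the certificates with carried corner codes, every other hypothesis is about the stripped list `cxs.map stripCert` (which a census data file
defines as its `certs`). [cite: Pohlmann1968, Thm. 1] [cite: Milne1999LefschetzClasses, Thm. 3.2] -/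
theorem hgen_of_preChecks (hmul : ∀ P Q : GalT F, e (P * Q) = Γ.mul (e P) (e Q)) (hconj : e conjT = Γ.conj)
    (reps : List (ℕ × ℕ × ℕ)) (cxs : List ((ℕ × ℕ × ℕ) × List ((ℕ × ℕ × ℕ) × List ℕ × ℤ) × List (ℕ × ℤ)))
    (hcs : (cxs.all fun c => Γ.isFaceB c.1 && Γ.certOKPre reps c.1 c.2.1 c.2.2) = true)
    (trans : List ℕ) (htrans : (Γ.cmTypes.all fun T => (List.finRange n).any fun j => trans.contains (Γ.twist j T)) = true)
    (hints : List ((ℕ × ℕ × ℕ) × ℕ × Fin n)) (hok : Γ.coverHintOK (cxs.map CMGaloisType.stripCert) hints = true)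
    (hcomp : Γ.hintFacesComplete trans hints = true)
    (horb : ((cxs.map CMGaloisType.stripCert).all fun c => c.2.1.all fun gi => (Γ.cellsFlat reps).contains gi.1) = true)
    (hpc : ((cxs.map CMGaloisType.stripCert).all fun c => c.2.2.all fun pj => Γ.isCMType pj.1) = true)
    (σ₀ : F →+* ℂ) (𝒮 : Set (Face F))
    (hreps : ∀ r ∈ reps, ∃ R ∈ 𝒮, (r.1 < 2 ^ n ∧ ∀ i : Fin n, mem i r.1 = true ↔ e.symm i ∈ (pullType R.Φ σ₀).1) ∧
      Γ.placeMask (e (translate σ₀ R.p)) = r.2.1 ∧ Γ.placeMask (e (translate σ₀ R.p')) = r.2.2)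
    (f : Face F) :
    lefChar f.corner (fun _ => ({σ₀} : Finset (F →+* ℂ))) ∈ AddSubgroup.closure
      {a : Asym F | ∃ g ∈ 𝒮, ∃ σ : F →+* ℂ, a = lefChar g.corner (fun _ => ({σ} : Finset (F →+* ℂ)))} :=
  hgen_of_certOK_coverTrans Γ e hmul hconj reps (cxs.map CMGaloisType.stripCert) (certsOK_of_pre Γ reps cxs hcs) trans htrans
    (cover_of_hints Γ _ trans hints hok hcomp) (horb_of_cellsFlat Γ reps _ horb) hpc σ₀ 𝒮 hreps f

end Summit.HodgeConjecture.CorCM.FaceCensus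

end
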